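import Literature.Probability.Percolation.AnchoredIsoperimetricProfile
import HarnessLib

/-!
# The isoperimetric profile of the supercritical infinite cluster inside a box (Pete 2008)

Topic `Literature/Probability/Percolation`. A NAMED FACT (D-0014), vendored as printed, from

* [Pete2008] G. Pete, *A note on percolation on `ℤ^d`: isoperimetric profile via exponential cluster
  repulsion*, Electron. Commun. Probab. **13** (2008) 377–392, doi:10.1214/ecp.v13-1390 =
  arXiv:math/0702474 (held text read this session: §1, Theorem 1.2 and Corollary 1.3, pp. 3–4 of
  the arXiv version).

**Corollary 1.3 as printed.** "For all `p > p_c(ℤ^d)` there exist `c₃(d,p) > 0`, `α(d,p) > 0` and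
(for almost all percolation configurations `ω`) an integer `N(ω)` such that for all `n > N(ω)`, all
connected subsets `S ⊆ 𝒞_∞ ∩ [-n,n]^d` with size `|S| ≥ c₃ (log n)^{d/(d-1)}` have
`|∂_{𝒞_∞} S| ≥ α |S|^{1-1/d}`." (Standing assumptions of the paper: bond percolation on `ℤ^d`,
`d ≥ 2`, `p > p_c(ℤ^d)`; `𝒞_∞` the (a.s. unique) infinite cluster; `∂_𝒞 S = E_𝒞(S, 𝒞 ∖ S)` the
edge boundary of `S` INSIDE the cluster graph `𝒞`, i.e. the OPEN edges with exactly one endpoint in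
`S`.) It is deduced there from Theorem 1.2 (`P_p(∃ S connected, o ∈ S ⊂ 𝒞, M ≤ |S| < ∞,
|∂⁺_𝒞 S| ≤ α|S|^{1-1/d}) ≤ exp(-c₂ M^{1-1/d})`) by Borel–Cantelli; earlier in-box isoperimetry of
the supercritical cluster: Mathieu–Remy (Ann. Probab. 32 (2004)), Benjamini–Mossel (2003),
Barlow (2004), Berger–Biskup–Hoffman–Kozma (AIHP 44 (2008)) — all for `p > p_c` via
Grimmett–Marstrand / Kesten–Zhang coarse graining (nothing is known at a hypothetically percolating
`p_c`).

## Rendering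

* `[-n,n]^d` is the tree's `LatticeModels.box d n` (`mem_box : x ∈ box d n ↔ ∀ i, -n ≤ x i ≤ n`).
* "`S ⊆ 𝒞_∞`": every `x ∈ S` lies in an infinite open cluster, `ω ∈ percolatesAt x`
  (for `p > p_c` the infinite cluster is a.s. unique, so this is the printed hypothesis a.s.).
* "connected" is connectedness in the cluster graph, whose edges are the OPEN edges: every two
  points of `S` are joined by an open path inside `S`, `ω ∈ openConnIn ↑S x y` (this is the notion
  the isoperimetry of the graph `𝒞_∞` refers to; it is implied by, hence at most as strong a
  requirement as, any reading that would only ask lattice-connectedness — the fact errs on the safe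
  side).
* `|∂_{𝒞_∞} S|` is the tree's `openEdgeBoundaryCard d ω S` (open edges of `ℤ^d` with exactly one
  endpoint in `S`; the other endpoint is then automatically in `𝒞_∞`), from
  `AnchoredIsoperimetricProfile.lean` (Cerf–Dembin's `∂_{C(0)} H`, same currency).
* `(log n)^{d/(d-1)}` and `|S|^{1-1/d}` are real powers `Real.rpow`; "almost all `ω` … an integer
  `N(ω)` … for all `n > N(ω)`" is `∀ᵐ ω, ∃ N, ∀ n > N`.

Grounds, for `p > p_c(ℤ³)` ONLY, the cut cruxes of route
`Summit.CriticalPhenomena.PercolationContinuityZ3.Theses.PercFoamCut`: `MacroCutQuadratic`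
(balanced parts of `𝒞_∞ ∩ Λ_n` cost `≥ c n²` open edges) and a fortiori `MacroCutLog` — decompose a
balanced part `A` into its open-connected components `J_i`; `Σ_i |∂ J_i| = |∂ A|` (no open edge joins
two components), components with `|J_i| ≥ c₃ (log n)^{3/2}` give `Σ |J_i|^{2/3} ≥ (Σ |J_i|)^{2/3}`,
the others contribute `≥ 1` each — exactly as Kesten–Zhang (`Grimmett1999_thm_8_65`, PROVED in tree)
grounds `FiniteClusterVolumeTail` for `p > p_c`. The content of those items is the hypothetical
percolating `p = p_c`, which no printed theorem reaches.

## References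

* G. Pete, Electron. Commun. Probab. 13 (2008) 377–392, Corollary 1.3 (and Theorem 1.2).
  [cite: Pete2008, Cor. 1.3]
-/

noncomputable section

namespace Literature.Probability.Percolation

open MeasureTheory Filter LatticeModels
open scoped Topology

/-- **Pete 2008, Corollary 1.3 (isoperimetric profile of the supercritical infinite cluster in a
box), as printed:** "For all `p > p_c(ℤ^d)` there exist `c₃(d,p) > 0`, `α(d,p) > 0` and (for almost
all percolation configurations `ω`) an integer `N(ω)` such that for all `n > N(ω)`, all connected
subsets `S ⊆ 𝒞_∞ ∩ [-n,n]^d` with size `|S| ≥ c₃ (log n)^{d/(d-1)}` have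
`|∂_{𝒞_∞} S| ≥ α |S|^{1-1/d}`" (bond percolation on `ℤ^d`, `d ≥ 2`; `∂_{𝒞_∞} S` = open edges with
exactly one endpoint in `S`; "connected" = connected through open edges inside `S`; `S ⊆ 𝒞_∞` = every
point of `S` percolates). Grounds `…Theses.PercFoamCut.MacroCutQuadratic` / `.MacroCutLog` for
`p > p_c(ℤ³)` only (component decomposition + subadditivity of `t ↦ t^{2/3}`); their content is the
case `p = p_c`. [cite: Pete2008, Cor. 1.3] -/
def Pete2008_cor13 : Prop :=
  ∀ d : ℕ, 2 ≤ d → ∀ p : unitInterval, criticalProb (zdGraph d) (0 : Site d) < (p : ℝ) →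
    ∃ c₃ α : ℝ, 0 < c₃ ∧ 0 < α ∧
      ∀ᵐ ω ∂(bondPercolation (zdGraph d) p), ∃ N : ℕ, ∀ n : ℕ, N < n →
        ∀ S : Finset (Site d), S ⊆ box d n →
          (∀ x ∈ S, ω ∈ percolatesAt x) →
          (∀ x ∈ S, ∀ y ∈ S, ω ∈ openConnIn (↑S : Set (Site d)) x y) →
          c₃ * Real.log (n : ℝ) ^ ((d : ℝ) / ((d : ℝ) - 1)) ≤ (S.card : ℝ) →
          α * (S.card : ℝ) ^ (1 - 1 / (d : ℝ)) ≤ (openEdgeBoundaryCard d ω S : ℝ)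

/-- **The case `d = 3`** of `Pete2008_cor13`, exponents written `3/2` and `2/3`: for `p > p_c(ℤ³)`
there are `c₃, α > 0` such that a.s. eventually in `n` every open-connected `S ⊆ 𝒞_∞ ∩ [-n,n]³` with
`|S| ≥ c₃ (log n)^{3/2}` has at least `α |S|^{2/3}` open boundary edges. [cite: Pete2008, Cor. 1.3] -/
theorem Pete2008_cor13.z3 (h : Pete2008_cor13) (p : unitInterval)
    (hp : criticalProb (zdGraph 3) (0 : Site 3) < (p : ℝ)) :
    ∃ c₃ α : ℝ, 0 < c₃ ∧ 0 < α ∧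
      ∀ᵐ ω ∂(bondPercolation (zdGraph 3) p), ∃ N : ℕ, ∀ n : ℕ, N < n →
        ∀ S : Finset (Site 3), S ⊆ box 3 n →
          (∀ x ∈ S, ω ∈ percolatesAt x) →
          (∀ x ∈ S, ∀ y ∈ S, ω ∈ openConnIn (↑S : Set (Site 3)) x y) →
          c₃ * Real.log (n : ℝ) ^ ((3 : ℝ) / 2) ≤ (S.card : ℝ) →
          α * (S.card : ℝ) ^ ((2 : ℝ) / 3) ≤ (openEdgeBoundaryCard 3 ω S : ℝ) := by
  obtain ⟨c₃, α, hc, hα, hae⟩ := h 3 (by norm_num) p hp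
  refine ⟨c₃, α, hc, hα, ?_⟩
  filter_upwards [hae] with ω hω
  obtain ⟨N, hN⟩ := hω
  refine ⟨N, fun n hn S hS hperc hconn hsize => ?_⟩
  have h1 : ((3 : ℕ) : ℝ) / (((3 : ℕ) : ℝ) - 1) = (3 : ℝ) / 2 := by norm_num
  have h2 : (1 : ℝ) - 1 / ((3 : ℕ) : ℝ) = (2 : ℝ) / 3 := by norm_num
  have := hN n hn S hS hperc hconn (by rw [h1]; exact hsize)
  rw [h2] at this
  exact this

end Literature.Probability.Percolation

end
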